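import Mathlib
import Literature.RingTheory.CohomologyAnnihilator.Localization
import Summits.ResolutionOfSingularities.ResolutionOfSingularities.Theorems.SyzygyFlatteningHigherRankTerminationEssFiniteType
import HarnessLib

/-!
# Persistence of the cohomology annihilator under localisation at the centre of a valuation

Crux `HomologicalConductor.Persistence` (stmt-ResolutionOfSingularities-16484), line `birth`,
registered stub `stub_localisationPersistence`.

For a field extension `K / k`, a valuation ring `O` of `K` and a noetherian `k`-subalgebra
`B ⊆ O` of `K`, the route's `loc B = k[a * s⁻¹ | a, s ∈ B, s⁻¹ ∈ O]` is verbatim the tree's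
`Theorems.SyzygyFlattening.locAt O B`, and it is a localisation of `B`: through the inclusion
`B ≤ locAt O B` (`self_le_locAt`) it satisfies `IsLocalization U (locAt O B)` for `U` the
preimage in `B` of the units of `locAt O B` (every element is `a * s⁻¹` with `a, s ∈ B`,
`O.valuation s = 1`, `mem_locAt_iff`, and such `s` are inverted in `locAt O B`,
`inv_mem_locAt`; injectivity of `B → locAt O B → K` gives the kernel condition). Hence
Iyengar–Takahashi 2014, Lemma 2.10(1) `U⁻¹ ca(R) ⊆ ca(U⁻¹R)` (tree
`Literature.RingTheory.CohomologyAnnihilator.algebraMap_mem_cohomologyAnnihilator_of_isLocalization`)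
applies, and since the inclusion commutes with the coercions to `K` the image of `ca B` in `K`
lies in the image of `ca (locAt O B)`.
-/

-- single-problem summit: the doubled namespace component is forced
set_option linter.dupNamespace false

noncomputable section

namespace Summit.ResolutionOfSingularities.ResolutionOfSingularities.Theorems.HomologicalConductor.PersistenceLocalisation

open Summit.ResolutionOfSingularities.ResolutionOfSingularities.Theorems.SyzygyFlattening
  (locAt self_le_locAt mem_locAt_iff inv_mem_locAt)
open Literature.AlgebraicGeometry.Resolution (ne_zero_of_valuation_eq_one)
open Literature.RingTheory.CohomologyAnnihilator

variable {k K : Type} [Field k] [Field K] [Algebra k K]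

/-- `locAt O B` (`B ⊆ O`), as a `B`-algebra through the inclusion `B ≤ locAt O B`, is the
localisation of `B` at the preimage of the units of `locAt O B`: every element is `a * s⁻¹`
with `a, s ∈ B` and `s` an `O`-unit, inverted in `locAt O B`. [folklore] -/
theorem isLocalization_locAt (O : ValuationSubring K) (B : Subalgebra k K)
    (h : B.toSubring ≤ O.toSubring) :
    @IsLocalization ↥B _
      ((IsUnit.submonoid ↥(locAt O B)).comap
        (Subalgebra.inclusion (self_le_locAt O B)).toRingHom)
      ↥(locAt O B) _ (Subalgebra.inclusion (self_le_locAt O B)).toRingHom.toAlgebra := by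
  letI : Algebra ↥B ↥(locAt O B) :=
    (Subalgebra.inclusion (self_le_locAt O B)).toRingHom.toAlgebra
  refine (isLocalization_iff _ _).mpr ⟨fun s => s.2, fun y => ?_, fun {a b} hab => ?_⟩
  · obtain ⟨a, ha, s, hs, hv, hy⟩ := (mem_locAt_iff O B h).mp y.2
    have hs0 : s ≠ 0 := ne_zero_of_valuation_eq_one hv
    have hsL : s ∈ locAt O B := self_le_locAt O B hs
    have hunit : IsUnit (algebraMap ↥B ↥(locAt O B) ⟨s, hs⟩) := by
      refine IsUnit.of_mul_eq_one ⟨s⁻¹, inv_mem_locAt O B h hsL hv⟩ (Subtype.ext ?_)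
      exact mul_inv_cancel₀ hs0
    refine ⟨(⟨a, ha⟩, ⟨⟨s, hs⟩, hunit⟩), Subtype.ext ?_⟩
    change (y : K) * s = a
    rw [hy, inv_mul_cancel_right₀ hs0]
  · have hab' : (a : K) = b := congrArg (fun t : ↥(locAt O B) => (t : K)) hab
    exact ⟨1, by rw [Subtype.ext hab']⟩

/-- **STUB `stub_localisationPersistence` (Iyengar–Takahashi 2014, Lemma 2.10(1)).** For a
noetherian `k`-subalgebra `B ⊆ O` of `K`, the image in `K` of the cohomology annihilator
`ca B` lies in the image of `ca (loc B)`, where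
`loc B = k[a * s⁻¹ | a, s ∈ B, s⁻¹ ∈ O]` (= tree `locAt O B`) is the localisation of `B` at
the centre of `O`: `U⁻¹ ca(R) ⊆ ca(U⁻¹R)`. [cite: IyengarTakahashi2014, Lemma 2.10(1)] -/
theorem stub_localisationPersistence : ∀ (k K : Type) [Field k] [Field K] [Algebra k K]
    (O : ValuationSubring K) (B : Subalgebra k K), B.toSubring ≤ O.toSubring →
    IsNoetherianRing ↥B →
    ((↑) : ↥B → K) '' (Literature.RingTheory.CohomologyAnnihilator.cohomologyAnnihilator ↥B :
        Set ↥B) ⊆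
      ((↑) : ↥(Algebra.adjoin k {y : K | ∃ a ∈ B, ∃ s ∈ B, s⁻¹ ∈ O ∧ y = a * s⁻¹}) → K) ''
        (Literature.RingTheory.CohomologyAnnihilator.cohomologyAnnihilator
          ↥(Algebra.adjoin k {y : K | ∃ a ∈ B, ∃ s ∈ B, s⁻¹ ∈ O ∧ y = a * s⁻¹}) : Set _) := by
  intro k K _ _ _ O B h hB
  haveI := hB
  -- the subalgebra in the goal is `locAt O B` by `rfl`
  change ((↑) : ↥B → K) '' (cohomologyAnnihilator ↥B : Set ↥B) ⊆
    ((↑) : ↥(locAt O B) → K) '' (cohomologyAnnihilator ↥(locAt O B) : Set ↥(locAt O B))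
  letI : Algebra ↥B ↥(locAt O B) :=
    (Subalgebra.inclusion (self_le_locAt O B)).toRingHom.toAlgebra
  haveI : IsLocalization ((IsUnit.submonoid ↥(locAt O B)).comap (algebraMap ↥B ↥(locAt O B)))
      ↥(locAt O B) := isLocalization_locAt O B h
  rintro _ ⟨x, hx, rfl⟩
  exact ⟨algebraMap ↥B ↥(locAt O B) x,
    algebraMap_mem_cohomologyAnnihilator_of_isLocalization
      (U := (IsUnit.submonoid ↥(locAt O B)).comap (algebraMap ↥B ↥(locAt O B))) ↥(locAt O B) hx,
    rfl⟩

end Summit.ResolutionOfSingularities.ResolutionOfSingularities.Theorems.HomologicalConductor.PersistenceLocalisation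

end
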